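import Mathlib.RingTheory.MvPolynomial.Homogeneous
import Mathlib.LinearAlgebra.Dual.Lemmas
import Mathlib.RingTheory.LocalRing.ResidueField.Basic
import Mathlib.Algebra.Algebra.Subalgebra.Basic
import Mathlib.RingTheory.Adjoin.Basic
import HarnessLib

/-!
# Hironaka's directrix and the invariant `τ` (CoP1, proof of Prop. 4.2; Hironaka, Giraud)

Topic: `Literature/AlgebraicGeometry/Resolution`. [CoP1] = Cossart–Piltant, J. Algebra 320
(2008), proof of Prop. 4.2, "Basic invariants for embedded singularities" (p. 7):

> "Let `x ∈ Σ` be a closed point. We denote `R := 𝒪_{X,x}` … `gr_𝔪(R) = k(x)[Y_1, Y_2, Y_3]`,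
> where `(y_1, y_2, y_3)` is a r.s.p. of `R` … Let `J_x := cl_μ J_x ⊆ k(x)[Y_1, Y_2, Y_3]_μ`. We
> call tangent cone of `E` at `x` the affine subscheme `C_x(E) ⊂ 𝔸³_{k(x)}` with ideal
> `J_x gr_𝔪(R)`. There exists a minimal `k(x)`-vector subspace `T_x ⊆ 𝔪/𝔪²` … such that
> `(J_x ∩ k(x)[T_x]) gr_𝔪(R) = J_x`, … i.e. such that `J_x` is generated by elements in
> `k(x)[T_x]`. This minimal `T_x` is called the directrix of `E` at `x`. Let
> `τ(x) := dim_{k(x)}(T_x)`. … This subscheme also has an intrinsic definition [21], [25]."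

DEFINITIONS (with bodies) and PROVED API, for a set `S` of polynomials in `k[Y_1, …, Y_d]`
(e.g. `S = cl_μ J_x`, `initialForms` below):

* `translate k w` — the translation `Y_i ↦ Y_i + w_i T` as a `k`-algebra endomorphism of
  `k[Y_1, …, Y_d, T]` (`T` an extra variable), `scaleT k a : T ↦ aT`; `translate_add`,
  `translate_smul_comp_scaleT` (the group law and homogeneity);
* `invarianceSpace k S ⊆ k^d` — **Hironaka's intrinsic directrix (as a space of tangent
  vectors)**: the vectors `w` with `F(Y + Tw) = F(Y)` for all `F ∈ S`, i.e. the largest linear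
  subspace by which the cone `V(S)` is invariant under translation — a `k`-subspace (PROVED);
* `directrix k S ⊆ (k^d)^∨` — **the directrix `T(S)`** as a space of linear forms: the
  annihilator of `invarianceSpace k S`; `hironakaTau k S := dim_k T(S)` — **the invariant `τ`**;
  `hironakaTau_add_finrank_invarianceSpace : τ + dim 𝕎 = d`;
* `linearFormPoly`, `linearFormsSubalgebra k T' = k[T']` — the subalgebra generated by the linear
  forms of `T'`; `dualCoannihilator_le_invarianceSpace`, `directrix_le_of_subset` — **minimality:
  if `S ⊆ k[T']` then `T(S) ⊆ T'`** (the linear forms of `T'` are fixed by the translations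
  along `T'^⊥`), the half of [CoP1]'s characterization "minimal `T_x` with `J_x ⊆ k(x)[T_x]`"
  saying that `T(S)` is below every such `T'`;
* `initialForms c J μ` — for a local ring `R` with `𝔪 = (c_1, …, c_d)`: **`cl_μ(J) ⊆ k[Y]_μ`**,
  the reductions `F̄` of the forms `F` of degree `μ` in `c` with `F(c) ∈ J` (a `k`-subspace);
  `hironakaTauAt c J μ := τ(cl_μ J)` — **`τ(x)`** for `R = 𝒪_{X,x}`, `J = J_x`, `μ = ord_x J`.

Not vendored here: the other half `S ⊆ k[T(S)]` of the characterization (Hironaka; needs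
coordinates adapted to `invarianceSpace`), near / very near points, Hironaka's Thm. 2.

## Sources

* V. Cossart, O. Piltant, J. Algebra 320 (2008), proof of Prop. 4.2, p. 7. [CossartPiltant2008]
* H. Hironaka, *Additive groups associated with points of a projective space*, Ann. of Math. 92
  (1970) — the intrinsic definition ([CoP1] ref. [25]); J. Giraud, *Contact maximal en
  caractéristique positive*, Ann. Sci. ÉNS 8 (1975) ([CoP1] ref. [21]). Background only.
-/

noncomputable section

open MvPolynomial

namespace Literature.AlgebraicGeometry.Resolution

universe u

/-! ## Translations of `k[Y_1, …, Y_d, T]` -/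

section Translation

variable (k : Type u) [CommRing k] {d : ℕ}

/-- **The translation `Y_i ↦ Y_i + w_i T`, `T ↦ T`** by the vector `w ∈ k^d`, as a `k`-algebra
endomorphism of `k[Y_1, …, Y_d, T]` (variables `some i = Y_i`, `none = T`).
[cite: CossartPiltant2008, proof of Prop. 4.2] -/
def translate (w : Fin d → k) :
    MvPolynomial (Option (Fin d)) k →ₐ[k] MvPolynomial (Option (Fin d)) k :=
  aeval fun o : Option (Fin d) => o.elim (X none) fun i => X (some i) + C (w i) * X none

/-- The scaling `T ↦ a T`, `Y_i ↦ Y_i`. [folklore] -/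
def scaleT (a : k) : MvPolynomial (Option (Fin d)) k →ₐ[k] MvPolynomial (Option (Fin d)) k :=
  aeval fun o : Option (Fin d) => o.elim (C a * X none) fun i => X (some i)

/-- `τ_w(T) = T`. [folklore] -/
@[simp] theorem translate_X_none (w : Fin d → k) : translate k w (X none) = X none := by
  simp [translate]

/-- `τ_w(Y_i) = Y_i + w_i T`. [folklore] -/
@[simp] theorem translate_X_some (w : Fin d → k) (i : Fin d) :
    translate k w (X (some i)) = X (some i) + C (w i) * X none := by
  simp [translate]

/-- `ρ_a(T) = aT`. [folklore] -/
@[simp] theorem scaleT_X_none (a : k) : scaleT k a (X none : MvPolynomial (Option (Fin d)) k) =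
    C a * X none := by
  simp [scaleT]

/-- `ρ_a(Y_i) = Y_i`. [folklore] -/
@[simp] theorem scaleT_X_some (a : k) (i : Fin d) : scaleT k a (X (some i)) = X (some i) := by
  simp [scaleT]

/-- Translating by `0` is the identity. [folklore] -/
theorem translate_zero : translate k (0 : Fin d → k) = AlgHom.id k _ := by
  refine MvPolynomial.algHom_ext fun o => ?_
  cases o with
  | none => simp
  | some i => simp

/-- **The group law**: translating by `w + w'` is translating by `w'` then by `w`. [folklore] -/
theorem translate_add (w w' : Fin d → k) :
    translate k (w + w') = (translate k w).comp (translate k w') := by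
  refine MvPolynomial.algHom_ext fun o => ?_
  cases o with
  | none => simp
  | some i =>
    rw [AlgHom.comp_apply, translate_X_some, translate_X_some, map_add, map_mul,
      MvPolynomial.algHom_C, MvPolynomial.algebraMap_eq, translate_X_some, translate_X_none,
      Pi.add_apply, C_add]
    ring

/-- **Homogeneity**: translating by `a • w` after scaling `T ↦ aT` is scaling after translating
by `w`. [folklore] -/
theorem translate_smul_comp_scaleT (a : k) (w : Fin d → k) :
    (translate k (a • w)).comp (scaleT k a) = (scaleT k a).comp (translate k w) := by
  refine MvPolynomial.algHom_ext fun o => ?_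
  cases o with
  | none => simp
  | some i =>
    rw [AlgHom.comp_apply, AlgHom.comp_apply, scaleT_X_some, translate_X_some, translate_X_some,
      map_add, map_mul, scaleT_X_some, MvPolynomial.algHom_C, MvPolynomial.algebraMap_eq,
      scaleT_X_none, Pi.smul_apply, smul_eq_mul, C_mul]
    ring

/-- Scaling `T` does not change polynomials in the `Y`'s. [folklore] -/
theorem scaleT_rename_some (a : k) (F : MvPolynomial (Fin d) k) :
    scaleT k a (rename some F) = rename some F := by
  have : (scaleT k a).comp (rename some) = (rename some : MvPolynomial (Fin d) k →ₐ[k] _) :=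
    MvPolynomial.algHom_ext fun i => by simp
  exact AlgHom.congr_fun this F

/-- **The vectors by which a set of polynomials is translation invariant**
`𝕎(S) = {w ∈ k^d | F(Y + Tw) = F(Y) for all F ∈ S}` — for the initial forms `S = cl_μ J_x` this
is the largest linear subspace leaving the tangent cone invariant under translation, i.e.
Hironaka's intrinsic form of the directrix ([CoP1]: "This subscheme also has an intrinsic
definition [21], [25]"). It is a `k`-subspace: the group law and homogeneity of translations.
[cite: CossartPiltant2008, proof of Prop. 4.2] -/
def invarianceSpace (S : Set (MvPolynomial (Fin d) k)) : Submodule k (Fin d → k) where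
  carrier := {w | ∀ F ∈ S, translate k w (rename some F) = rename some F}
  zero_mem' F _ := by rw [translate_zero]; rfl
  add_mem' {w w'} hw hw' F hF := by
    rw [translate_add, AlgHom.comp_apply, hw' F hF, hw F hF]
  smul_mem' a w hw F hF := by
    have h := AlgHom.congr_fun (translate_smul_comp_scaleT k a w) (rename some F)
    rw [AlgHom.comp_apply, AlgHom.comp_apply, scaleT_rename_some, hw F hF,
      scaleT_rename_some] at h
    exact h

/-- Membership in `𝕎(S)`. [folklore] -/
theorem mem_invarianceSpace_iff {S : Set (MvPolynomial (Fin d) k)} {w : Fin d → k} :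
    w ∈ invarianceSpace k S ↔ ∀ F ∈ S, translate k w (rename some F) = rename some F :=
  Iff.rfl

/-- `𝕎` is antitone in `S`. [folklore] -/
theorem invarianceSpace_antitone {S S' : Set (MvPolynomial (Fin d) k)} (h : S ⊆ S') :
    invarianceSpace k S' ≤ invarianceSpace k S :=
  fun _ hw F hF => hw F (h hF)

/-- The polynomials fixed by the translation by `w` form a subalgebra (the equalizer of two
algebra maps). [folklore] -/
def fixedSubalgebra (w : Fin d → k) : Subalgebra k (MvPolynomial (Fin d) k) :=
  AlgHom.equalizer ((translate k w).comp (rename some)) (rename some)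

/-- Membership in the fixed subalgebra. [folklore] -/
theorem mem_fixedSubalgebra_iff {w : Fin d → k} {F : MvPolynomial (Fin d) k} :
    F ∈ fixedSubalgebra k w ↔ translate k w (rename some F) = rename some F :=
  Iff.rfl

/-! ## Linear forms and the subalgebras `k[T']` -/

/-- The linear form `Σᵢ ℓ(eᵢ) Yᵢ ∈ k[Y]` attached to `ℓ ∈ (k^d)^∨`. [folklore] -/
def linearFormPoly (ℓ : Module.Dual k (Fin d → k)) : MvPolynomial (Fin d) k :=
  ∑ i, C (ℓ (Pi.single i 1)) * X i

/-- **`k[T']`**: the subalgebra of `k[Y_1, …, Y_d]` generated by the linear forms of a space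
`T'` of linear forms ([CoP1]: "`k(x)[T_x] = Sym(T_x) ⊆ Sym(𝔪/𝔪²) = gr_𝔪(R)`").
[cite: CossartPiltant2008, proof of Prop. 4.2] -/
def linearFormsSubalgebra (T' : Submodule k (Module.Dual k (Fin d → k))) :
    Subalgebra k (MvPolynomial (Fin d) k) :=
  Algebra.adjoin k (linearFormPoly k '' (T' : Set (Module.Dual k (Fin d → k))))

/-- A linear functional on `k^d` is evaluation against its values on the standard basis.
[folklore] -/
theorem dual_apply_eq_sum (ℓ : Module.Dual k (Fin d → k)) (w : Fin d → k) :
    ℓ w = ∑ i, w i * ℓ (Pi.single i 1) := by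
  conv_lhs => rw [show w = ∑ i, w i • (Pi.single i 1 : Fin d → k) from by
    ext j; simp [Finset.sum_apply, Pi.single_apply]]
  rw [map_sum]
  exact Finset.sum_congr rfl fun i _ => by rw [map_smul, smul_eq_mul]

/-- **Translating a linear form**: `ℓ(Y + Tw) = ℓ(Y) + ℓ(w) T`. [folklore] -/
theorem translate_rename_linearFormPoly (w : Fin d → k) (ℓ : Module.Dual k (Fin d → k)) :
    translate k w (rename some (linearFormPoly k ℓ)) =
      rename some (linearFormPoly k ℓ) + C (ℓ w) * X none := by
  have h1 : rename some (linearFormPoly k ℓ) =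
      ∑ i, C (ℓ (Pi.single i 1)) * (X (some i) : MvPolynomial (Option (Fin d)) k) := by
    rw [linearFormPoly, map_sum]
    exact Finset.sum_congr rfl fun i _ => by rw [map_mul, rename_C, rename_X]
  have h2 : translate k w (rename some (linearFormPoly k ℓ)) =
      ∑ i, C (ℓ (Pi.single i 1)) * (X (some i) + C (w i) * X none) := by
    rw [h1, map_sum]
    exact Finset.sum_congr rfl fun i _ => by
      rw [map_mul, MvPolynomial.algHom_C, MvPolynomial.algebraMap_eq, translate_X_some]
  rw [h2, h1, dual_apply_eq_sum, map_sum, Finset.sum_mul, ← Finset.sum_add_distrib]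
  exact Finset.sum_congr rfl fun i _ => by rw [map_mul]; ring

/-- Linear forms vanishing on `w` are fixed by the translation by `w`. [folklore] -/
theorem linearFormPoly_mem_fixedSubalgebra {w : Fin d → k} {ℓ : Module.Dual k (Fin d → k)}
    (h : ℓ w = 0) : linearFormPoly k ℓ ∈ fixedSubalgebra k w := by
  rw [mem_fixedSubalgebra_iff, translate_rename_linearFormPoly, h, map_zero, zero_mul, add_zero]

/-- **If `S ⊆ k[T']` then `S` is invariant under the translations along `T'^⊥`**: the linear
forms of `T'` are fixed by such translations, hence so is the subalgebra they generate.
[cite: CossartPiltant2008, proof of Prop. 4.2] -/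
theorem dualCoannihilator_le_invarianceSpace {S : Set (MvPolynomial (Fin d) k)}
    {T' : Submodule k (Module.Dual k (Fin d → k))} (hS : S ⊆ linearFormsSubalgebra k T') :
    T'.dualCoannihilator ≤ invarianceSpace k S := by
  intro w hw F hF
  rw [Submodule.mem_dualCoannihilator] at hw
  have hle : linearFormsSubalgebra k T' ≤ fixedSubalgebra k w := by
    refine Algebra.adjoin_le ?_
    rintro _ ⟨ℓ, hℓ, rfl⟩
    exact linearFormPoly_mem_fixedSubalgebra k (hw ℓ hℓ)
  exact (mem_fixedSubalgebra_iff k).mp (hle (hS hF))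

end Translation

/-! ## The directrix and `τ` -/

section Directrix

variable (k : Type u) [Field k] {d : ℕ}

/-- **The directrix `T(S) ⊆ (k^d)^∨`** of a set `S` of polynomials (for `S = cl_μ J_x`: the
directrix `T_x ⊆ 𝔪/𝔪²` of [CoP1]), as the space of linear forms vanishing on the invariance
space `𝕎(S)` (Hironaka's intrinsic definition). That it is the MINIMAL `T'` with `S ⊆ k[T']`
([CoP1]'s definition) consists of `directrix_le_of_subset` below and the inclusion
`S ⊆ k[T(S)]` (Hironaka; not proved here). [cite: CossartPiltant2008, proof of Prop. 4.2] -/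
def directrix (S : Set (MvPolynomial (Fin d) k)) : Submodule k (Module.Dual k (Fin d → k)) :=
  (invarianceSpace k S).dualAnnihilator

/-- **`τ(S) := dim_k T(S)`** ([CoP1]: "`τ(x) := dim_{k(x)}(T_x)`").
[cite: CossartPiltant2008, proof of Prop. 4.2] -/
def hironakaTau (S : Set (MvPolynomial (Fin d) k)) : ℕ :=
  Module.finrank k (directrix k S)

/-- Membership in the directrix. [folklore] -/
theorem mem_directrix_iff {S : Set (MvPolynomial (Fin d) k)} {ℓ : Module.Dual k (Fin d → k)} :
    ℓ ∈ directrix k S ↔ ∀ w ∈ invarianceSpace k S, ℓ w = 0 :=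
  Submodule.mem_dualAnnihilator ℓ

/-- **`τ(S) + dim 𝕎(S) = d`.** [folklore] -/
theorem hironakaTau_add_finrank_invarianceSpace (S : Set (MvPolynomial (Fin d) k)) :
    hironakaTau k S + Module.finrank k (invarianceSpace k S) = d := by
  rw [hironakaTau, directrix, add_comm, Subspace.finrank_add_finrank_dualAnnihilator_eq,
    Module.finrank_fin_fun]

/-- `τ(S) ≤ d`. [folklore] -/
theorem hironakaTau_le (S : Set (MvPolynomial (Fin d) k)) : hironakaTau k S ≤ d := by
  have := hironakaTau_add_finrank_invarianceSpace k S
  omega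

/-- The directrix is monotone in `S`. [folklore] -/
theorem directrix_mono {S S' : Set (MvPolynomial (Fin d) k)} (h : S ⊆ S') :
    directrix k S ≤ directrix k S' :=
  Submodule.dualAnnihilator_anti (invarianceSpace_antitone k h)

/-- **Minimality of the directrix** ([CoP1]: `T_x` is the minimal subspace `T` with
`J_x ⊆ k(x)[T]`; here the half "`T(S) ⊆ T'` for every `T'` with `S ⊆ k[T']`"): the translations
along `T'^⊥` fix `S`, so `T'^⊥ ⊆ 𝕎(S)` and `T(S) = 𝕎(S)^⊥ ⊆ T'^⊥⊥ = T'`.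
[cite: CossartPiltant2008, proof of Prop. 4.2] -/
theorem directrix_le_of_subset {S : Set (MvPolynomial (Fin d) k)}
    {T' : Submodule k (Module.Dual k (Fin d → k))} (hS : S ⊆ linearFormsSubalgebra k T') :
    directrix k S ≤ T' := by
  have h := Submodule.dualAnnihilator_anti (dualCoannihilator_le_invarianceSpace k hS)
  rwa [Subspace.dualCoannihilator_dualAnnihilator_eq] at h

/-- Consequently `τ(S) ≤ dim T'` whenever `S ⊆ k[T']`. [cite: CossartPiltant2008, proof of Prop. 4.2] -/
theorem hironakaTau_le_finrank_of_subset {S : Set (MvPolynomial (Fin d) k)}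
    {T' : Submodule k (Module.Dual k (Fin d → k))} (hS : S ⊆ linearFormsSubalgebra k T') :
    hironakaTau k S ≤ Module.finrank k T' :=
  Submodule.finrank_mono (directrix_le_of_subset k hS)

/-- The empty set (or a set of constants) has directrix `0` and `τ = 0`. [folklore] -/
theorem directrix_empty : directrix k (∅ : Set (MvPolynomial (Fin d) k)) = ⊥ := by
  have : invarianceSpace k (∅ : Set (MvPolynomial (Fin d) k)) = ⊤ :=
    eq_top_iff.mpr fun w _ F hF => hF.elim
  rw [directrix, this, Submodule.dualAnnihilator_top]

end Directrix

/-! ## Initial forms of an ideal of a local ring: `cl_μ(J)` -/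

section InitialForms

open IsLocalRing

variable {R : Type u} [CommRing R] [IsLocalRing R] {d : ℕ} (c : Fin d → R)

/-- **`cl_μ(J) ⊆ k[Y_1, …, Y_d]_μ`** ([CoP1]: "`J_x := cl_μ J_x ⊆ k(x)[Y_1, Y_2, Y_3]_μ`"), for an
ideal `J` of a local ring `R` with residue field `k` and elements `c_1, …, c_d` (a regular system
of parameters of a regular `R`, so that `gr_𝔪(R) = k[Y]` via `Y_i ↦ in(c_i)`): the reductions
`F̄` modulo `𝔪` of the forms `F` of degree `μ` in `c` with `F(c) ∈ J` — the degree-`μ` initial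
forms of the elements of `J` of order `≥ μ` (zero for those of order `> μ`). A `k`-subspace.
[cite: CossartPiltant2008, proof of Prop. 4.2] -/
def initialForms (J : Ideal R) (μ : ℕ) : Submodule (ResidueField R) (MvPolynomial (Fin d) (ResidueField R)) where
  carrier := {G | ∃ F : MvPolynomial (Fin d) R, F.IsHomogeneous μ ∧ MvPolynomial.eval c F ∈ J ∧
    MvPolynomial.map (residue R) F = G}
  zero_mem' := ⟨0, MvPolynomial.isHomogeneous_zero _ _ _, by rw [map_zero]; exact J.zero_mem,
    map_zero _⟩
  add_mem' := by
    rintro _ _ ⟨F, hF, hFJ, rfl⟩ ⟨G, hG, hGJ, rfl⟩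
    exact ⟨F + G, hF.add hG, by rw [map_add]; exact J.add_mem hFJ hGJ, map_add _ _ _⟩
  smul_mem' := by
    rintro a _ ⟨F, hF, hFJ, rfl⟩
    obtain ⟨a, rfl⟩ := residue_surjective a
    refine ⟨C a * F, ?_, by rw [map_mul, eval_C]; exact J.mul_mem_left _ hFJ, ?_⟩
    · simpa using (MvPolynomial.isHomogeneous_C _ a).mul hF
    · rw [map_mul, map_C, smul_eq_C_mul]

/-- Membership in `cl_μ(J)`. [folklore] -/
theorem mem_initialForms_iff {J : Ideal R} {μ : ℕ} {G : MvPolynomial (Fin d) (ResidueField R)} :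
    G ∈ initialForms c J μ ↔ ∃ F : MvPolynomial (Fin d) R, F.IsHomogeneous μ ∧
      MvPolynomial.eval c F ∈ J ∧ MvPolynomial.map (residue R) F = G :=
  Iff.rfl

/-- The elements of `cl_μ(J)` are forms of degree `μ`. [folklore] -/
theorem isHomogeneous_of_mem_initialForms {J : Ideal R} {μ : ℕ}
    {G : MvPolynomial (Fin d) (ResidueField R)} (hG : G ∈ initialForms c J μ) :
    G.IsHomogeneous μ := by
  obtain ⟨F, hF, -, rfl⟩ := hG
  exact hF.map _

/-- `cl_μ` is monotone in `J`. [folklore] -/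
theorem initialForms_mono {J J' : Ideal R} (h : J ≤ J') (μ : ℕ) :
    initialForms c J μ ≤ initialForms c J' μ := by
  rintro _ ⟨F, hF, hFJ, rfl⟩
  exact ⟨F, hF, h hFJ, rfl⟩

/-- **`τ` of an ideal at order `μ`** ([CoP1]: `τ(x)` for `R = 𝒪_{X,x}`, `J = J_x`,
`μ = ord_x J`): the dimension of the directrix of `cl_μ(J)`.
[cite: CossartPiltant2008, proof of Prop. 4.2] -/
def hironakaTauAt (J : Ideal R) (μ : ℕ) : ℕ :=
  hironakaTau (ResidueField R) (initialForms c J μ : Set (MvPolynomial (Fin d) (ResidueField R)))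

/-- `τ ≤ d = emb.dim`. [folklore] -/
theorem hironakaTauAt_le (J : Ideal R) (μ : ℕ) : hironakaTauAt c J μ ≤ d :=
  hironakaTau_le _ _

end InitialForms

end Literature.AlgebraicGeometry.Resolution

end
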